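import Summits.BirchSwinnertonDyer.Rank1Residual.GaloisImage.KummerSubgroupCocycles
import Summits.BirchSwinnertonDyer.Rank1Residual.GaloisImage.ModPLatticeHerbrandCount
import HarnessLib

/-!
# The equivariant Kummer isomorphism `Eˣ/Eˣⁿ ≃ Hom_cont(Gal(k̄/E), μₙ)` for `μₙ ⊆ E`
# (cell `b2b-bsdres`, team n1011, row T-EPC = Tate's local Euler–Poincaré characteristic; seat p04 GEN 8; stage C3a)

HONEST FRAMING (cell `b2b-bsdres`, run/shared/lean/b2b/bsd-rank1-residual/, verbatim in every
file): the goal of the cell is to DELETE the COMBINATION-SHAPED residual classes of the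
Birch–Swinnerton-Dyer formula for ALL analytic-rank `≤ 1` elliptic curves over `ℚ` — "full BSD
formula for every rank `≤ 1` curve in class `C`" assembled STRICTLY from published theorems — so
that the rank-`≤ 1` remainder becomes exactly the CONSTRUCTION-SHAPED classes, which are TYPED
(missing-input `Prop`s), NOT attempted. This is not "finishing BSD". Team n1011 (N10 / N11, the
additive block X4 ∧ `p = 3`): research route; no claim beyond the stated classes; nothing is
booked; no mark / label is changed by this file. Theorems only (no definition, no named fact, no
`sorry`); TOOL theorems of Galois cohomology.  (Placement: Summits/GaloisImage with the T-EPC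
cone.)

## What

For a field `k` of characteristic `0`, `n ≥ 1`, and a normal subextension `E ⊆ k̄` whose fixing
group `N = Gal(k̄/E)` (the tree's `galFixing k E`) acts trivially on `μₙ(k̄)` (i.e. `μₙ ⊆ E`):

* `KummerSubgroup.exists_equivariant_bijective` — there is a bijective additive map
  `Ψ : Eˣ/Eˣⁿ → Z¹_cont(N, μₙ)` (`= Hom_cont(N, μₙ)`, the tree's `contOneCocycles` of the restricted
  module `μₙ`) with `Ψ(u)(m) = m(α)/α` for ANY `α ∈ k̄ˣ` with `αⁿ = u`, and which is
  `Γ_k`-EQUIVARIANT: `Ψ(g · x) = g · Ψ(x)`, `Γ_k` acting on `Eˣ/Eˣⁿ` through `Gal(E/k)`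
  (`resGal E`, the representation `ofMulDistribMulAction (E ≃ₐ[k] E) Eˣ` of stages B1–B7 pulled
  back to `Γ_k`, modulo `n`) and on cocycles by conjugation, `(g·φ)(m) = g φ(g⁻¹ m g)` (the tree's
  `contOneCocycles.pullback (subgroupConj N g) (conjRepHom _ N g)`).

This is "`H¹(Gal(K̄/L), ℤ/pℤ) ≅ L^×/L^{×p}` as `G`-modules" in Milne's proof of *ADT* I Thm. 2.8
(p. 34, with `μ_p ⊆ L`), assembled from the cocycle-level facts of stage C2
(`KummerSubgroupCocycles`: existence, Hilbert 90 surjectivity, triviality `↔ α ∈ E`, conjugation).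

References: J. S. Milne, *Arithmetic Duality Theorems* (2006), I §2, proof of Thm. 2.8
[MilneADT2006]; J.-P. Serre, *Local Fields* (1979), X §3 [SerreLocalFields1979].
-/

noncomputable section

open CategoryTheory Function Field
open Literature.NumberTheory.GaloisRepresentations
open Literature.NumberTheory.GaloisRepresentations.DiscreteGaloisModule
open Literature.NumberTheory.GaloisRepresentations.LocalWeilDatum (galFixing mem_galFixing_iff)
open Literature.NumberTheory.EllipticCurves (subgroupConj subgroupConj_apply_coe)

universe u

namespace Summit.BirchSwinnertonDyer.Rank1Residual.GaloisImage

namespace KummerSubgroup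

variable (k : Type u) [Field k] (n : ℕ) (E : IntermediateField k (AlgebraicClosure k))

/-- Two `n`-th roots of the same element have the same Kummer cocycle on a subgroup fixing `μₙ`:
if `αⁿ = βⁿ` and `m` fixes `μₙ(k̄)` then `m(α)/α = m(β)/β`. [folklore] -/
theorem smul_div_eq_of_pow_eq (hn : 0 < n)
    (hμ : ∀ g ∈ galFixing k E, ∀ ζ : MuCarrier k n, mu k n g ζ = ζ)
    {α β : (AlgebraicClosure k)ˣ} (h : α ^ n = β ^ n) {m : absoluteGaloisGroup k}
    (hm : m ∈ galFixing k E) : m • α / α = m • β / β := by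
  have hζ : (α / β) ^ n = 1 := by rw [div_pow, h, div_self']
  let ζ : rootsOfUnity n (AlgebraicClosure k) := ⟨α / β, (mem_rootsOfUnity _ _).2 hζ⟩
  have hfix : m • (α / β) = α / β := by
    have h1 := congrArg (fun v => muVal k n v) (hμ m hm (MuCarrier.ofRootsOfUnity ζ))
    rw [muVal_apply, muVal_ofRootsOfUnity] at h1
    exact h1
  have _ := hn
  have h2 : m • α / m • β = α / β := by rw [← smul_div', hfix]
  rw [div_eq_div_iff_mul_eq_mul] at h2 ⊢
  rw [h2, mul_comm]

/-- The `k̄`-value of the Galois action on `Eˣ` through `Gal(E/k)`: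
`((resGal E g) • u : k̄) = g • (u : k̄)`. [folklore] -/
theorem coe_resGal_smul_units [Normal k E] (g : absoluteGaloisGroup k) (u : (↥E)ˣ) :
    (((resGal E g • u : (↥E)ˣ) : E) : AlgebraicClosure k) = g • ((u : E) : AlgebraicClosure k) :=
  coe_resGal_apply E g (u : E)

/-- `n`-th roots in `k̄ˣ` of units of `E`. [folklore] -/
theorem exists_root (hn : 0 < n) (u : (↥E)ˣ) :
    ∃ α : (AlgebraicClosure k)ˣ, (α : AlgebraicClosure k) ^ n = ((u : E) : AlgebraicClosure k) := by
  obtain ⟨z, hz⟩ := IsAlgClosed.exists_pow_nat_eq (((u : E) : AlgebraicClosure k)) hn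
  have hz0 : z ≠ 0 := by
    rintro rfl
    rw [zero_pow hn.ne'] at hz
    have h0 : ((u : E) : AlgebraicClosure k) = 0 := hz.symm
    exact Units.ne_zero u (by exact_mod_cast h0)
  exact ⟨Units.mk0 z hz0, hz⟩

/-- For `α ∈ k̄ˣ` with `αⁿ ∈ E`, `αⁿ` is fixed by `Gal(k̄/E)`. [folklore] -/
theorem pow_fixed_of_pow_eq (α : (AlgebraicClosure k)ˣ) (u : (↥E)ˣ)
    (hα : (α : AlgebraicClosure k) ^ n = ((u : E) : AlgebraicClosure k)) :
    ∀ g ∈ galFixing k E, g • α ^ n = α ^ n := fun g hg =>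
  Units.ext (by
    rw [Units.coe_smul, Units.val_pow_eq_pow_val, hα]
    exact (mem_galFixing_iff k).1 hg _ (u : E).2)

/-- **A Kummer cocycle for each unit of `E`**: for `u ∈ Eˣ` there is a continuous cocycle `φ` of
`Gal(k̄/E)` with values `φ(m) = m(α)/α` for EVERY `n`-th root `α` of `u` (the choice of root does not
matter because `μₙ` is fixed by `Gal(k̄/E)`). [cite: SerreLocalFields1979, X §3] -/
theorem exists_cocycle_units (hn : 0 < n)
    (hμ : ∀ g ∈ galFixing k E, ∀ ζ : MuCarrier k n, mu k n g ζ = ζ) (u : (↥E)ˣ) :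
    ∃ φ : contOneCocycles (subgroupRep (mu k n).toTopRep (galFixing k E)),
      ∀ α : (AlgebraicClosure k)ˣ, (α : AlgebraicClosure k) ^ n = ((u : E) : AlgebraicClosure k) →
        ∀ m : galFixing k E, muVal k n (φ.1 m) = (m : absoluteGaloisGroup k) • α / α := by
  obtain ⟨α₀, hα₀⟩ := exists_root k n E hn u
  obtain ⟨φ, hφ⟩ := exists_cocycle k n E α₀ (pow_fixed_of_pow_eq k n E α₀ u hα₀)
  refine ⟨φ, fun α hα m => ?_⟩
  rw [hφ]
  refine smul_div_eq_of_pow_eq k n E hn hμ (Units.ext ?_) m.2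
  rw [Units.val_pow_eq_pow_val, Units.val_pow_eq_pow_val, hα₀, hα]

section Family

variable {k n E}
variable (Φ : (↥E)ˣ → contOneCocycles (subgroupRep (mu k n).toTopRep (galFixing k E)))
  (hΦ : ∀ (u : (↥E)ˣ) (α : (AlgebraicClosure k)ˣ),
    (α : AlgebraicClosure k) ^ n = ((u : E) : AlgebraicClosure k) →
    ∀ m : galFixing k E, muVal k n ((Φ u).1 m) = (m : absoluteGaloisGroup k) • α / α)
include hΦ

/-- A family of Kummer cocycles `u ↦ (m ↦ m(ⁿ√u)/ⁿ√u)` is multiplicative. [folklore] -/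
theorem family_mul (hn : 0 < n) (u v : (↥E)ˣ) : Φ (u * v) = Φ u + Φ v := by
  obtain ⟨α, hα⟩ := exists_root k n E hn u
  obtain ⟨β, hβ⟩ := exists_root k n E hn v
  refine cocycle_eq_of_muVal_eq k n E fun m => ?_
  have hαβ : ((α * β : (AlgebraicClosure k)ˣ) : AlgebraicClosure k) ^ n =
      (((u * v : (↥E)ˣ) : E) : AlgebraicClosure k) := by
    rw [Units.val_mul, mul_pow, hα, hβ, Units.val_mul]; rfl
  rw [hΦ (u * v) (α * β) hαβ m, smul_div_mul]
  change _ = muVal k n ((Φ u).1 m + (Φ v).1 m)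
  rw [muVal_add, hΦ u α hα m, hΦ v β hβ m]

/-- A family of Kummer cocycles vanishes on `n`-th powers. [folklore] -/
theorem family_pow (w : (↥E)ˣ) : Φ (w ^ n) = 0 := by
  refine cocycle_eq_of_muVal_eq k n E fun m => ?_
  have hw0 : ((w : E) : AlgebraicClosure k) ≠ 0 := by exact_mod_cast Units.ne_zero w
  have hroot : ((Units.mk0 _ hw0 : (AlgebraicClosure k)ˣ) : AlgebraicClosure k) ^ n =
      (((w ^ n : (↥E)ˣ) : E) : AlgebraicClosure k) := by
    rw [Units.val_mk0, Units.val_pow_eq_pow_val]; rfl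
  rw [hΦ _ _ hroot m]
  have hfix : (m : absoluteGaloisGroup k) • (Units.mk0 _ hw0 : (AlgebraicClosure k)ˣ) = Units.mk0 _ hw0 :=
    Units.ext (by rw [Units.coe_smul, Units.val_mk0]; exact (mem_galFixing_iff k).1 m.2 _ (w : E).2)
  rw [hfix, div_self']
  rfl

/-- A family of Kummer cocycles has kernel exactly the `n`-th powers (characteristic `0`: a trivial
cocycle means `ⁿ√u ∈ E` by the Galois correspondence). [cite: SerreLocalFields1979, X §3] -/
theorem family_eq_zero_iff [CharZero k] (hn : 0 < n) (u : (↥E)ˣ) :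
    Φ u = 0 ↔ ∃ w : (↥E)ˣ, w ^ n = u := by
  constructor
  · intro hu
    obtain ⟨α, hα⟩ := exists_root k n E hn u
    have hmem : ((α : (AlgebraicClosure k)ˣ) : AlgebraicClosure k) ∈ E := by
      rw [← forall_smul_div_eq_one_iff_mem]
      intro g
      have h := hΦ u α hα g
      rw [hu] at h
      change muVal k n 0 = _ at h
      rw [muVal_zero] at h
      exact h.symm
    have hw0 : (⟨_, hmem⟩ : E) ≠ 0 := by
      intro h
      exact Units.ne_zero α (congrArg (fun z : E => (z : AlgebraicClosure k)) h)
    refine ⟨Units.mk0 _ hw0, Units.ext (Subtype.ext ?_)⟩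
    change ((α : (AlgebraicClosure k)ˣ) : AlgebraicClosure k) ^ n = ((u : E) : AlgebraicClosure k)
    exact hα
  · rintro ⟨w, rfl⟩
    exact family_pow Φ hΦ w

/-- A family of Kummer cocycles is onto the continuous cocycles (Hilbert 90 for `Gal(k̄/E)`).
[cite: SerreLocalFields1979, X §1 Prop. 2, X §3] -/
theorem family_surjective [CharZero k] : Surjective Φ := by
  intro φ
  obtain ⟨α, hαN, hαφ⟩ := exists_eq_smul_div k n E φ
  have hmem : ((α ^ n : (AlgebraicClosure k)ˣ) : AlgebraicClosure k) ∈ E := by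
    rw [← forall_smul_eq_iff_mem]
    intro g hg
    have := congrArg Units.val (hαN g hg)
    rwa [Units.coe_smul] at this
  have hw0 : (⟨_, hmem⟩ : E) ≠ 0 := by
    intro h
    exact Units.ne_zero (α ^ n) (congrArg (fun z : E => (z : AlgebraicClosure k)) h)
  refine ⟨Units.mk0 _ hw0, cocycle_eq_of_muVal_eq k n E fun m => ?_⟩
  rw [hΦ (Units.mk0 _ hw0) α (Units.val_pow_eq_pow_val α n).symm m, hαφ]

/-- A family of Kummer cocycles is `Γ_k`-equivariant for `E/k` normal: the cocycle of `g(u)` is the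
conjugate `m ↦ g φ(g⁻¹ m g)` of the cocycle `φ` of `u`. [cite: MilneADT2006, I §2 proof of Thm 2.8] -/
theorem family_smul [Normal k E] [(galFixing k E).Normal] (hn : 0 < n) (g : absoluteGaloisGroup k)
    (u : (↥E)ˣ) :
    Φ (resGal E g • u) = contOneCocycles.pullback (subgroupConj (galFixing k E) g)
      (conjRepHom (mu k n).toTopRep (galFixing k E) g) (Φ u) := by
  obtain ⟨α, hα⟩ := exists_root k n E hn u
  refine cocycle_eq_of_muVal_eq k n E fun m => ?_
  have hroot : ((g • α : (AlgebraicClosure k)ˣ) : AlgebraicClosure k) ^ n =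
      (((resGal E g • u : (↥E)ˣ) : E) : AlgebraicClosure k) := by
    rw [coe_resGal_smul_units, Units.coe_smul, ← smul_pow', hα]
  rw [hΦ _ _ hroot m, muVal_conj_pullback k n E (Φ u) α (hΦ u α hα) g m]

/-- A family of Kummer cocycles descends to a bijective additive map `Eˣ/Eˣⁿ → Z¹_cont(N, μₙ)`
(characteristic `0`). [cite: SerreLocalFields1979, X §3] -/
theorem family_exists_bijective [CharZero k] (hn : 0 < n) :
    ∃ Ψ : (Additive (↥E)ˣ ⧸ LinearMap.range (LinearMap.lsmul ℤ (Additive (↥E)ˣ) n)) →+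
        contOneCocycles (subgroupRep (mu k n).toTopRep (galFixing k E)),
      Bijective Ψ ∧ ∀ u : (↥E)ˣ, Ψ (Submodule.Quotient.mk (Additive.ofMul u)) = Φ u := by
  set P : Submodule ℤ (Additive (↥E)ˣ) := LinearMap.range (LinearMap.lsmul ℤ (Additive (↥E)ˣ) n)
    with hP
  -- the additive map on `Additive Eˣ`
  obtain ⟨Ψ₀, hΨ₀⟩ : ∃ Ψ₀ : Additive (↥E)ˣ →+ contOneCocycles (subgroupRep (mu k n).toTopRep (galFixing k E)),
      ∀ x, Ψ₀ x = Φ (Additive.toMul x) :=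
    ⟨AddMonoidHom.mk' (fun x => Φ (Additive.toMul x)) fun x y => by
      rw [toMul_add, family_mul Φ hΦ hn], fun x => rfl⟩
  have hker : P ≤ LinearMap.ker Ψ₀.toIntLinearMap := by
    rintro _ ⟨x, rfl⟩
    rw [LinearMap.mem_ker, LinearMap.lsmul_apply, AddMonoidHom.coe_toIntLinearMap, hΨ₀, toMul_zsmul,
      zpow_natCast, family_pow Φ hΦ]
  -- its descent to the quotient
  obtain ⟨Ψ₁, hΨ₁⟩ : ∃ Ψ₁ : (Additive (↥E)ˣ ⧸ P) →+ contOneCocycles (subgroupRep (mu k n).toTopRep (galFixing k E)),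
      ∀ u : (↥E)ˣ, Ψ₁ (Submodule.Quotient.mk (Additive.ofMul u)) = Φ u :=
    ⟨(P.liftQ Ψ₀.toIntLinearMap hker).toAddMonoidHom, fun u => by
      rw [LinearMap.toAddMonoidHom_coe, Submodule.liftQ_apply, AddMonoidHom.coe_toIntLinearMap, hΨ₀,
        toMul_ofMul]⟩
  have hΨ₁' : ∀ x : Additive (↥E)ˣ, Ψ₁ (Submodule.Quotient.mk x) = Φ (Additive.toMul x) := fun x =>
    hΨ₁ (Additive.toMul x)
  refine ⟨Ψ₁, ⟨?_, fun φ => ?_⟩, hΨ₁⟩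
  · rw [injective_iff_map_eq_zero]
    intro x hx
    induction x using Submodule.Quotient.induction_on with
    | H x =>
    rw [hΨ₁'] at hx
    obtain ⟨w, hw⟩ := (family_eq_zero_iff Φ hΦ hn _).1 hx
    rw [Submodule.Quotient.mk_eq_zero]
    refine ⟨Additive.ofMul w, ?_⟩
    rw [LinearMap.lsmul_apply]
    change Additive.ofMul (w ^ (n : ℤ)) = x
    rw [zpow_natCast, hw]
    rfl
  · obtain ⟨u, hu⟩ := family_surjective Φ hΦ φ
    exact ⟨Submodule.Quotient.mk (Additive.ofMul u), (hΨ₁ u).trans hu⟩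

end Family

/-- **The equivariant Kummer isomorphism for the subgroup `Gal(k̄/E)`.**  For `k` of characteristic
`0`, `n ≥ 1`, `E/k` normal inside `k̄` with `μₙ(k̄)` fixed by `N = Gal(k̄/E)`: a BIJECTIVE additive
map `Ψ : Eˣ/Eˣⁿ → Z¹_cont(N, μₙ)` with `Ψ(u)(m) = m(α)/α` whenever `αⁿ = u`, and
`Ψ(g·x) = g·Ψ(x)` for `g ∈ Γ_k` (`Γ_k` acting on `Eˣ` through `Gal(E/k)` and on cocycles by
conjugation).  Injectivity: a trivial cocycle means `α ∈ E` (Galois correspondence); surjectivity: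
Hilbert 90 for `N`.  (Stated with `→+` and `Bijective`, not `≃ₗ[ℤ]`: the two `ℤ`-module structures
on a submodule quotient are only propositionally cheap to identify.)
[cite: MilneADT2006, I §2 proof of Thm 2.8 (p. 34)] [cite: SerreLocalFields1979, X §3] -/
theorem exists_equivariant_bijective [CharZero k] (hn : 0 < n) [Normal k E] [(galFixing k E).Normal]
    (hμ : ∀ g ∈ galFixing k E, ∀ ζ : MuCarrier k n, mu k n g ζ = ζ) :
    ∃ Ψ : (Additive (↥E)ˣ ⧸ LinearMap.range (LinearMap.lsmul ℤ (Additive (↥E)ˣ) n)) →+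
        contOneCocycles (subgroupRep (mu k n).toTopRep (galFixing k E)),
      Bijective Ψ ∧
      (∀ (u : (↥E)ˣ) (α : (AlgebraicClosure k)ˣ),
          (α : AlgebraicClosure k) ^ n = ((u : E) : AlgebraicClosure k) →
        ∀ m : galFixing k E,
          muVal k n ((Ψ (Submodule.Quotient.mk (Additive.ofMul u))).1 m) =
            (m : absoluteGaloisGroup k) • α / α) ∧
      (∀ (g : absoluteGaloisGroup k) (x : Additive (↥E)ˣ ⧸ LinearMap.range (LinearMap.lsmul ℤ (Additive (↥E)ˣ) n)),
        Ψ (Representation.quotient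
            ((Representation.ofMulDistribMulAction (↥E ≃ₐ[k] ↥E) (↥E)ˣ).comp (resGal E)) _
            (ModPRepCount.range_lsmul_le_comap
              ((Representation.ofMulDistribMulAction (↥E ≃ₐ[k] ↥E) (↥E)ˣ).comp (resGal E)) n) g x) =
          contOneCocycles.pullback (subgroupConj (galFixing k E) g)
            (conjRepHom (mu k n).toTopRep (galFixing k E) g) (Ψ x)) := by
  set ρU : Representation ℤ (absoluteGaloisGroup k) (Additive (↥E)ˣ) :=
    (Representation.ofMulDistribMulAction (↥E ≃ₐ[k] ↥E) (↥E)ˣ).comp (resGal E) with hρU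
  set P : Submodule ℤ (Additive (↥E)ˣ) := LinearMap.range (LinearMap.lsmul ℤ (Additive (↥E)ˣ) n)
    with hP
  have hquot : ∀ (g : absoluteGaloisGroup k) (x : Additive (↥E)ˣ),
      Representation.quotient ρU P (ModPRepCount.range_lsmul_le_comap ρU n) g (Submodule.Quotient.mk x) =
        Submodule.Quotient.mk (ρU g x) := fun g x => by
    rw [Representation.quotient_apply, Submodule.mapQ_apply]
  have hρUg : ∀ (g : absoluteGaloisGroup k) (x : Additive (↥E)ˣ),
      ρU g x = Additive.ofMul (resGal E g • Additive.toMul x) := fun g x => by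
    rw [hρU, MonoidHom.comp_apply, Representation.ofMulDistribMulAction_apply_apply]
  -- the family of Kummer cocycles and its descent
  choose Φ hΦ using exists_cocycle_units k n E hn hμ
  obtain ⟨Ψ, hbij, hΨ⟩ := family_exists_bijective Φ hΦ hn
  refine ⟨Ψ, hbij, fun u α hα m => ?_, fun g x => ?_⟩
  · rw [hΨ]
    exact hΦ u α hα m
  · induction x using Submodule.Quotient.induction_on with
    | H x =>
    have h2 : Ψ (Submodule.Quotient.mk x) = Φ (Additive.toMul x) := hΨ (Additive.toMul x)
    rw [hquot, hρUg, hΨ, h2, family_smul Φ hΦ hn]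

end KummerSubgroup

end Summit.BirchSwinnertonDyer.Rank1Residual.GaloisImage

end
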